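import Summits.QuantumFields.QCD.Theses.SpectralDefectExtinction
import Literature.MathematicalPhysics.QuantumFieldTheory.QCDPhaseQuenched
import Literature.MathematicalPhysics.QuantumFieldTheory.SpectralDefectDensity
import Literature.Barriers.QuantumFields.WilsonDeterminantMassSplitting
import Literature.Analysis.InnerProduct.CourantFischerBounds

/-!
# Bridge lemma I toward stub `coareaWegner` of line `Sketch` (skeleton "ResolventCell", gen 2) for
crux `SpectralDefectExtinction.WegnerEstimate` (item stmt-QuantumFields-8966):
Hellmann–Feynman for CLUSTERS of sorted eigenvalues, branch-free (replaces Rellich–Kato)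

The 1-D route of the paper proof (Lines/Sketch.md §gen 2) integrates `Σ_j |J_d(u_j)| φ_ε(λ_j)`
along a one-link circle `t ↦ H(t)` and needs, at almost every `t`, the level-velocity identity
`J_d(u_j) = ⟨u_j, H'(t) u_j⟩ = λ_j'(t)` for EVERY orthonormal eigenbasis `(u_j)` of `H(t)` — also at
permanently degenerate `t`, where no eigenvalue is simple and the implicit-function route fails.
Classically this is read off Rellich's analytic branches (Kato II §6).  This file proves the needed
identity WITHOUT branches, for Mathlib's decreasingly SORTED eigenvalues
`Λ_i(t) = eigenvalues₀ (H t) i` (Lipschitz in `t` by Weyl, hence differentiable a.e.):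

* `coareaWegner_cluster_deriv_eq` — if two sorted eigenvalues coincide at `t₀` and are both
  differentiable there, their derivatives agree (`Λ_i − Λ_{i'} ≥ 0` has a minimum at `t₀`);
* `coareaWegner_rayleigh_hasDerivAt` — THE CLUSTER HELLMANN–FEYNMAN THEOREM (operator form): for a
  family of symmetric operators `T(t)` on a finite-dimensional inner product space, a unit
  eigenvector `x` of `T(t₀)` with eigenvalue `λ₀`, `‖(T(t) − T(t₀)) x‖² = O((t − t₀)²)`, and ALL sorted
  eigenvalues differentiable at `t₀`, the Rayleigh quotient `t ↦ re ⟪T(t) x, x⟫` is differentiable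
  at `t₀` with derivative `Λ_i'(t₀)` for ANY sorted index `i` with `Λ_i(t₀) = λ₀`.  Proof: expand
  `re ⟪T(t)x, x⟫ − λ₀ − (t − t₀)Λ'_i = Σ_k (Λ_k(t) − λ₀ − (t − t₀)Λ'_i) |⟪b_k(t), x⟫|²` in the eigenbasis
  of `T(t)`; the cluster terms are `o(t − t₀)` by differentiability (all cluster derivatives agree),
  and the weights off the cluster are `O((t − t₀)²)` because
  `Σ_k (Λ_k(t) − λ₀)² |⟪b_k(t), x⟫|² = ‖(T(t) − λ₀) x‖² = ‖(T(t) − T(t₀)) x‖²`;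
* `coareaWegner_cluster_hellmannFeynman` — matrix form: for `H : ℝ → Matrix n n ℂ` Hermitian with
  entrywise derivative `H'` at `t₀`, all `t ↦ eigenvalues₀ (H t) i` differentiable at `t₀`, and any
  unit `u` with `H(t₀) u = λ₀ u`: `re (u⋆ H' u) = Λ_i'(t₀)` for every `i` with `Λ_i(t₀) = λ₀`.

Consequently (used downstream): at such `t₀`, for every orthonormal eigenbasis `(u_j, λ_j)` of
`H(t₀)`, `Σ_j |re (u_j⋆ H' u_j)| φ(λ_j) = Σ_i |Λ_i'(t₀)| φ(Λ_i(t₀))`.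
-/

noncomputable section

namespace Summit.QuantumFields.QCD.Cruxes.WegnerEstimate.ResolventCell

open MeasureTheory Filter Asymptotics
open scoped Matrix BigOperators InnerProductSpace Topology
open Literature.MathematicalPhysics.QuantumLattice Literature.MathematicalPhysics.QuantumFieldTheory
  Literature.Probability.LatticeModels
open Literature.Analysis.InnerProduct (re_inner_apply_self_eq_sum norm_sq_eq_sum_eigenvectorBasis)
open Matrix
open scoped ComplexOrder

section Operator

variable {𝕜 : Type*} [RCLike 𝕜] {E : Type*} [NormedAddCommGroup E] [InnerProductSpace 𝕜 E]
  [FiniteDimensional 𝕜 E] {N : ℕ}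

/-- **Shifted Parseval in the eigenbasis.**  For a symmetric `T` with sorted eigenvalues `λ_k` and
orthonormal eigenvector basis `b_k`, any vector `x` and real `c`:
`‖T x − c x‖² = Σ_k (λ_k − c)² |⟪b_k, x⟫|²`. -/
theorem coareaWegner_norm_sq_apply_sub_smul {T : E →ₗ[𝕜] E} (hT : T.IsSymmetric)
    (hn : Module.finrank 𝕜 E = N) (x : E) (c : ℝ) :
    ‖T x - ((c : ℝ) : 𝕜) • x‖ ^ 2 =
      ∑ k, (hT.eigenvalues hn k - c) ^ 2 * ‖⟪hT.eigenvectorBasis hn k, x⟫_𝕜‖ ^ 2 := by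
  rw [← (hT.eigenvectorBasis hn).sum_sq_norm_inner_right (T x - ((c : ℝ) : 𝕜) • x)]
  refine Finset.sum_congr rfl fun k _ => ?_
  have h : ⟪hT.eigenvectorBasis hn k, T x - ((c : ℝ) : 𝕜) • x⟫_𝕜 =
      (((hT.eigenvalues hn k - c : ℝ)) : 𝕜) * ⟪hT.eigenvectorBasis hn k, x⟫_𝕜 := by
    rw [inner_sub_right, inner_smul_right, ← hT (hT.eigenvectorBasis hn k) x,
      hT.apply_eigenvectorBasis, inner_smul_left, RCLike.conj_ofReal, RCLike.ofReal_sub]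
    ring
  rw [h, norm_mul, mul_pow, RCLike.norm_ofReal, sq_abs]

/-- **Cluster derivatives agree.**  If two decreasingly sorted eigenvalue functions `Λ_i ≥ Λ_{i'}`
(`i ≤ i'`) coincide at `t₀` and are both differentiable there, then their derivatives coincide:
the non-negative function `Λ_i − Λ_{i'}` has a minimum at `t₀`. -/
theorem coareaWegner_cluster_deriv_eq {Λ : Fin N → ℝ → ℝ} (hanti : ∀ t, Antitone fun i => Λ i t)
    {t₀ : ℝ} {i i' : Fin N} {D D' : ℝ} (hD : HasDerivAt (Λ i) D t₀) (hD' : HasDerivAt (Λ i') D' t₀)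
    (heq : Λ i t₀ = Λ i' t₀) : D = D' := by
  wlog hle : i ≤ i' generalizing i i' D D'
  · exact (this hD' hD heq.symm (le_of_not_ge hle)).symm
  have hmin : IsLocalMin (fun t => Λ i t - Λ i' t) t₀ :=
    Filter.Eventually.of_forall fun t => by
      show Λ i t₀ - Λ i' t₀ ≤ Λ i t - Λ i' t
      rw [heq, sub_self, sub_nonneg]
      exact hanti t hle
  have h := hmin.hasDerivAt_eq_zero (hD.sub hD')
  linarith

/-- **Cluster Hellmann–Feynman theorem (operator form, branch-free).**  Let `T(t)` be symmetric
operators on a finite-dimensional inner product space, `x` a unit eigenvector of `T(t₀)` with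
eigenvalue `λ₀`, suppose `‖(T(t) − T(t₀)) x‖² = O((t − t₀)²)` at `t₀` and that every sorted eigenvalue
`t ↦ Λ_k(t)` is differentiable at `t₀` with derivative `Λ'_k`.  Then for every sorted index `i` with
`Λ_i(t₀) = λ₀`, the Rayleigh quotient `t ↦ re ⟪T(t) x, x⟫` has derivative `Λ'_i` at `t₀`. -/
theorem coareaWegner_rayleigh_hasDerivAt {T : ℝ → E →ₗ[𝕜] E} (hT : ∀ t, (T t).IsSymmetric)
    (hn : Module.finrank 𝕜 E = N) {t₀ : ℝ} {x : E} (hx : ‖x‖ = 1) {lam₀ : ℝ}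
    (hTx : T t₀ x = ((lam₀ : ℝ) : 𝕜) • x)
    (hlip : (fun t => ‖(T t - T t₀) x‖ ^ 2) =O[𝓝 t₀] fun t => (t - t₀) ^ 2)
    {Λ' : Fin N → ℝ} (hdiff : ∀ k, HasDerivAt (fun t => (hT t).eigenvalues hn k) (Λ' k) t₀)
    {i : Fin N} (hi : (hT t₀).eigenvalues hn i = lam₀) :
    HasDerivAt (fun t => RCLike.re ⟪T t x, x⟫_𝕜) (Λ' i) t₀ := by
  -- eigen-coordinates of `x` at time `t`
  set Λ : Fin N → ℝ → ℝ := fun k t => (hT t).eigenvalues hn k with hΛ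
  set w : Fin N → ℝ → ℝ := fun k t => ‖⟪(hT t).eigenvectorBasis hn k, x⟫_𝕜‖ ^ 2 with hw
  have hw0 : ∀ k t, 0 ≤ w k t := fun k t => by positivity
  have hwsum : ∀ t, ∑ k, w k t = 1 := by
    intro t
    have h := norm_sq_eq_sum_eigenvectorBasis (hT t) hn x
    rw [hx, one_pow] at h
    exact h.symm
  have hw1 : ∀ k t, w k t ≤ 1 := fun k t =>
    (Finset.single_le_sum (fun j _ => hw0 j t) (Finset.mem_univ k)).trans_eq (hwsum t)
  have hr : ∀ t, RCLike.re ⟪T t x, x⟫_𝕜 = ∑ k, Λ k t * w k t := fun t =>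
    re_inner_apply_self_eq_sum (hT t) hn x
  have hs : ∀ t, ‖(T t - T t₀) x‖ ^ 2 = ∑ k, (Λ k t - lam₀) ^ 2 * w k t := by
    intro t
    have : (T t - T t₀) x = T t x - ((lam₀ : ℝ) : 𝕜) • x := by rw [LinearMap.sub_apply, hTx]
    rw [this]
    exact coareaWegner_norm_sq_apply_sub_smul (hT t) hn x lam₀
  have hanti : ∀ t, Antitone fun k => Λ k t := fun t => (hT t).eigenvalues_antitone hn
  -- the value at `t₀`
  have hr0 : RCLike.re ⟪T t₀ x, x⟫_𝕜 = lam₀ := by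
    rw [hTx, inner_smul_left, RCLike.conj_ofReal, inner_self_eq_norm_sq_to_K, hx]
    simp
  -- reduce to: `Σ_k (Λ_k(t) − λ₀ − (t − t₀)Λ'_i) w_k(t) = o(t − t₀)`
  rw [hasDerivAt_iff_isLittleO]
  have hexp : ∀ t, RCLike.re ⟪T t x, x⟫_𝕜 - RCLike.re ⟪T t₀ x, x⟫_𝕜 - (t - t₀) • Λ' i =
      ∑ k, (Λ k t - lam₀ - (t - t₀) * Λ' i) * w k t := by
    intro t
    rw [hr0, hr t, smul_eq_mul]
    have h1 := hwsum t
    calc ∑ k, Λ k t * w k t - lam₀ - (t - t₀) * Λ' i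
        = ∑ k, Λ k t * w k t - lam₀ * ∑ k, w k t - (t - t₀) * Λ' i * ∑ k, w k t := by
          rw [h1, mul_one, mul_one]
      _ = ∑ k, (Λ k t - lam₀ - (t - t₀) * Λ' i) * w k t := by
          rw [Finset.mul_sum, Finset.mul_sum, ← Finset.sum_sub_distrib, ← Finset.sum_sub_distrib]
          refine Finset.sum_congr rfl fun k _ => ?_
          ring
  simp_rw [hexp]
  refine IsLittleO.sum fun k _ => ?_
  by_cases hk : Λ k t₀ = lam₀
  · -- a cluster index: its derivative is `Λ'_i`, and `w ≤ 1`
    have hkd : Λ' k = Λ' i := coareaWegner_cluster_deriv_eq hanti (hdiff k) (hdiff i) (hk.trans hi.symm)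
    have h1 : (fun t => Λ k t - lam₀ - (t - t₀) * Λ' i) =o[𝓝 t₀] fun t => t - t₀ := by
      have h := (hdiff k).isLittleO
      rw [← hk, ← hkd]
      simpa only [smul_eq_mul] using h
    have h2 : (fun t => w k t) =O[𝓝 t₀] fun _ => (1 : ℝ) :=
      IsBigO.of_bound 1 (Filter.Eventually.of_forall fun t => by
        rw [Real.norm_of_nonneg (hw0 k t), norm_one, mul_one]
        exact hw1 k t)
    exact (h1.mul_isBigO h2).congr_right fun t => mul_one _
  · -- off the cluster: the weight is `O((t − t₀)²)`
    have hgap : 0 < |Λ k t₀ - lam₀| := abs_pos.2 (sub_ne_zero.2 hk)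
    set g : ℝ := |Λ k t₀ - lam₀| with hg
    -- eventually `|Λ_k(t) − λ₀| ≥ g/2` and `|Λ_k(t) − λ₀| ≤ 2g`
    have hcont : ContinuousAt (Λ k) t₀ := (hdiff k).continuousAt
    have hev : ∀ᶠ t in 𝓝 t₀, g / 2 ≤ |Λ k t - lam₀| ∧ |Λ k t - lam₀| ≤ 2 * g := by
      have h := Metric.tendsto_nhds.1 hcont (g / 2) (by positivity)
      filter_upwards [h] with t ht
      rw [Real.dist_eq] at ht
      constructor
      · have := abs_sub_abs_le_abs_sub (Λ k t₀ - lam₀) (Λ k t - lam₀)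
        have h' : |Λ k t₀ - lam₀ - (Λ k t - lam₀)| = |Λ k t - Λ k t₀| := by
          rw [← abs_neg]; congr 1; ring
        linarith
      · have := abs_sub_abs_le_abs_sub (Λ k t - lam₀) (Λ k t₀ - lam₀)
        have h' : |Λ k t - lam₀ - (Λ k t₀ - lam₀)| = |Λ k t - Λ k t₀| := by
          congr 1; ring
        linarith
    -- the bound on `‖(T t − T t₀)x‖²`
    obtain ⟨C, hC⟩ := isBigO_iff.1 hlip
    have hbound : ∀ᶠ t in 𝓝 t₀,
        ‖(Λ k t - lam₀ - (t - t₀) * Λ' i) * w k t‖ ≤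
          ((2 * g + |Λ' i|) * ((2 / g) ^ 2 * |C|)) * ‖(t - t₀) ^ 2‖ := by
      have hnear : ∀ᶠ t in 𝓝 t₀, |t - t₀| ≤ 1 := by
        have : ∀ᶠ t in 𝓝 t₀, dist t t₀ < 1 := Metric.eventually_nhds_iff.2 ⟨1, one_pos, fun t ht => ht⟩
        filter_upwards [this] with t ht
        rw [Real.dist_eq] at ht
        exact ht.le
      filter_upwards [hev, hC, hnear] with t ht hCt htn
      obtain ⟨hlo, hhi⟩ := ht
      have hw_le : w k t ≤ (2 / g) ^ 2 * |C| * (t - t₀) ^ 2 := by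
        -- `w ≤ (2/g)² (Λ_k − λ₀)² w ≤ (2/g)² ‖(T t − T t₀)x‖² ≤ (2/g)² |C| (t − t₀)²`
        have h1 : 1 ≤ (2 / g) ^ 2 * (Λ k t - lam₀) ^ 2 := by
          rw [← mul_pow, ← sq_abs ((2 / g) * _), abs_mul, abs_of_pos (by positivity : (0 : ℝ) < 2 / g)]
          have : 1 ≤ 2 / g * |Λ k t - lam₀| := by
            rw [div_mul_eq_mul_div, le_div_iff₀ hgap]
            linarith
          nlinarith
        have h2 : (Λ k t - lam₀) ^ 2 * w k t ≤ ‖(T t - T t₀) x‖ ^ 2 := by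
          rw [hs t]
          exact Finset.single_le_sum (f := fun j => (Λ j t - lam₀) ^ 2 * w j t)
            (fun j _ => mul_nonneg (sq_nonneg _) (hw0 j t)) (Finset.mem_univ k)
        have h3 : ‖(T t - T t₀) x‖ ^ 2 ≤ |C| * (t - t₀) ^ 2 := by
          have := hCt
          rw [Real.norm_of_nonneg (sq_nonneg _), Real.norm_of_nonneg (sq_nonneg _)] at this
          exact this.trans (mul_le_mul_of_nonneg_right (le_abs_self C) (sq_nonneg _))
        calc w k t = 1 * w k t := (one_mul _).symm
          _ ≤ ((2 / g) ^ 2 * (Λ k t - lam₀) ^ 2) * w k t := mul_le_mul_of_nonneg_right h1 (hw0 k t)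
          _ = (2 / g) ^ 2 * ((Λ k t - lam₀) ^ 2 * w k t) := by ring
          _ ≤ (2 / g) ^ 2 * (|C| * (t - t₀) ^ 2) :=
              mul_le_mul_of_nonneg_left (h2.trans h3) (by positivity)
          _ = (2 / g) ^ 2 * |C| * (t - t₀) ^ 2 := by ring
      have hfac : |Λ k t - lam₀ - (t - t₀) * Λ' i| ≤ 2 * g + |Λ' i| := by
        calc |Λ k t - lam₀ - (t - t₀) * Λ' i| ≤ |Λ k t - lam₀| + |(t - t₀) * Λ' i| := abs_sub _ _
          _ ≤ 2 * g + |t - t₀| * |Λ' i| := by rw [abs_mul]; exact add_le_add hhi le_rfl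
          _ ≤ 2 * g + 1 * |Λ' i| := by gcongr
          _ = 2 * g + |Λ' i| := by rw [one_mul]
      rw [norm_mul, Real.norm_eq_abs, Real.norm_of_nonneg (hw0 k t), Real.norm_of_nonneg (sq_nonneg _)]
      calc |Λ k t - lam₀ - (t - t₀) * Λ' i| * w k t
          ≤ (2 * g + |Λ' i|) * ((2 / g) ^ 2 * |C| * (t - t₀) ^ 2) :=
            mul_le_mul hfac hw_le (hw0 k t) (by positivity)
        _ = (2 * g + |Λ' i|) * ((2 / g) ^ 2 * |C|) * (t - t₀) ^ 2 := by ring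
    have hO : (fun t => (Λ k t - lam₀ - (t - t₀) * Λ' i) * w k t) =O[𝓝 t₀] fun t => (t - t₀) ^ 2 :=
      IsBigO.of_bound _ hbound
    have hsq : (fun t : ℝ => (t - t₀) ^ 2) =o[𝓝 t₀] fun t => t - t₀ := by
      have h := isLittleO_pow_sub_sub t₀ (one_lt_two)
      refine h.congr_left fun t => ?_
      rw [Real.norm_eq_abs, sq_abs]
    exact hO.trans_isLittleO hsq

end Operator

/-! ### Matrix form -/

/-- The Rayleigh quotient of a fixed vector along a matrix family is differentiable where the
entries are, with derivative the Rayleigh quotient of the derivative matrix. -/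
theorem coareaWegner_rayleigh_matrix_hasDerivAt {n : Type*} [Fintype n] [DecidableEq n]
    (H : ℝ → Matrix n n ℂ) (H' : Matrix n n ℂ) (t₀ : ℝ)
    (hderiv : ∀ p q, HasDerivAt (fun t => H t p q) (H' p q) t₀) (u : n → ℂ) :
    HasDerivAt (fun t => (star u ⬝ᵥ (H t).mulVec u).re) (star u ⬝ᵥ H'.mulVec u).re t₀ := by
  have h1 : HasDerivAt (fun t => star u ⬝ᵥ (H t).mulVec u) (star u ⬝ᵥ H'.mulVec u) t₀ := by
    simp only [dotProduct, mulVec, Finset.mul_sum]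
    refine HasDerivAt.fun_sum fun p _ => HasDerivAt.fun_sum fun q _ => ?_
    exact ((hderiv p q).mul_const (u q)).const_mul (star u p)
  have h2 := Complex.reCLM.hasFDerivAt.comp_hasDerivAt t₀ h1
  simpa only [Function.comp_def, Complex.reCLM_apply] using h2

/-- **Cluster Hellmann–Feynman theorem (matrix form, branch-free).**  Let `H : ℝ → Matrix n n ℂ` be
Hermitian-valued with entrywise derivative `H'` at `t₀`, and suppose every decreasingly sorted
eigenvalue function `t ↦ eigenvalues₀ (H t) i` is differentiable at `t₀` with derivative `Λ'_i`
(true for a.e. `t₀` along a Lipschitz family).  Then for every unit vector `u` with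
`H(t₀) u = λ₀ u` and every sorted index `i` with `Λ_i(t₀) = λ₀`:
`re (u⋆ H' u) = Λ'_i` — the colour current of ANY eigenvector in the `λ₀`-cluster is the common
level velocity of the cluster (and in particular the same for all eigenvectors of the cluster). -/
theorem coareaWegner_cluster_hellmannFeynman {n : Type*} [Fintype n] [DecidableEq n]
    (H : ℝ → Matrix n n ℂ) (hH : ∀ t, (H t).IsHermitian) (H' : Matrix n n ℂ) (t₀ : ℝ)
    (hderiv : ∀ p q, HasDerivAt (fun t => H t p q) (H' p q) t₀)
    (Λ' : Fin (Fintype.card n) → ℝ)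
    (hdiff : ∀ i, HasDerivAt (fun t => (hH t).eigenvalues₀ i) (Λ' i) t₀)
    (u : n → ℂ) (hu : star u ⬝ᵥ u = 1) (lam₀ : ℝ) (hHu : (H t₀).mulVec u = (lam₀ : ℂ) • u)
    (i : Fin (Fintype.card n)) (hi : (hH t₀).eigenvalues₀ i = lam₀) :
    (star u ⬝ᵥ H'.mulVec u).re = Λ' i := by
  -- pass to the Euclidean space and the symmetric operators `toEuclideanLin (H t)`
  set T : ℝ → EuclideanSpace ℂ n →ₗ[ℂ] EuclideanSpace ℂ n := fun t => Matrix.toEuclideanLin (H t)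
    with hTdef
  have hT : ∀ t, (T t).IsSymmetric := fun t => Matrix.isSymmetric_toEuclideanLin_iff.mpr (hH t)
  set x : EuclideanSpace ℂ n := WithLp.toLp 2 u with hxdef
  -- `eigenvalues₀` IS the sorted operator spectrum
  have hΛ : ∀ t k, (hH t).eigenvalues₀ k = (hT t).eigenvalues finrank_euclideanSpace k := fun t k => rfl
  -- the Rayleigh quotient in matrix terms
  have hray : ∀ t, RCLike.re ⟪T t x, x⟫_ℂ = (star u ⬝ᵥ (H t).mulVec u).re := by
    intro t
    have h1 : ⟪T t x, x⟫_ℂ = star (star u ⬝ᵥ (H t).mulVec u) := by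
      rw [EuclideanSpace.inner_eq_star_dotProduct, hTdef]
      simp only [hxdef, Matrix.toLpLin_toLp, Matrix.toLin'_apply, WithLp.ofLp_toLp]
      rw [star_dotProduct, star_star, dotProduct_comm]
    rw [h1]
    exact Complex.conj_re _
  -- `x` is a unit eigenvector
  have hx : ‖x‖ = 1 := by
    have h2 : ‖x‖ ^ 2 = 1 := by
      rw [@norm_sq_eq_re_inner ℂ, EuclideanSpace.inner_eq_star_dotProduct]
      simp only [hxdef, WithLp.ofLp_toLp]
      rw [dotProduct_comm, hu]
      simp
    have h3 := norm_nonneg x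
    nlinarith [h2]
  have hTx : T t₀ x = ((lam₀ : ℝ) : ℂ) • x := by
    simp only [hTdef, hxdef, Matrix.toLpLin_toLp, Matrix.toLin'_apply, hHu, WithLp.toLp_smul]
  -- `‖(T t − T t₀) x‖² = O((t − t₀)²)` from the entrywise derivative
  have hlip : (fun t => ‖(T t - T t₀) x‖ ^ 2) =O[𝓝 t₀] fun t => (t - t₀) ^ 2 := by
    have hcoord : ∀ t, ‖(T t - T t₀) x‖ ^ 2 = ∑ p, ‖∑ q, (H t p q - H t₀ p q) * u q‖ ^ 2 := by
      intro t
      have h1 : (T t - T t₀) x = WithLp.toLp 2 ((H t - H t₀).mulVec u) := by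
        rw [LinearMap.sub_apply]
        simp only [hTdef, hxdef, Matrix.toLpLin_toLp, Matrix.toLin'_apply, Matrix.sub_mulVec,
          WithLp.toLp_sub]
      rw [h1, EuclideanSpace.norm_sq_eq]
      rfl
    simp_rw [hcoord]
    refine IsBigO.sum fun p _ => ?_
    have h1 : (fun t => ∑ q, (H t p q - H t₀ p q) * u q) =O[𝓝 t₀] fun t => t - t₀ := by
      refine IsBigO.sum fun q _ => ?_
      have h := (hderiv p q).isBigO_sub
      simpa only [mul_comm] using h.const_mul_left (u q)
    simpa only [norm_pow, norm_norm] using (h1.norm_left).pow 2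
  -- differentiability of the sorted operator eigenvalues
  have hdiff' : ∀ k, HasDerivAt (fun t => (hT t).eigenvalues finrank_euclideanSpace k) (Λ' k) t₀ :=
    fun k => by simpa only [hΛ] using hdiff k
  have hi' : (hT t₀).eigenvalues finrank_euclideanSpace i = lam₀ := by rw [← hΛ]; exact hi
  -- the operator theorem, read back in matrix terms, and uniqueness of the derivative
  have hop := coareaWegner_rayleigh_hasDerivAt hT finrank_euclideanSpace hx hTx hlip hdiff' hi'
  have hop' : HasDerivAt (fun t => (star u ⬝ᵥ (H t).mulVec u).re) (Λ' i) t₀ := by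
    have : (fun t => RCLike.re ⟪T t x, x⟫_ℂ) = fun t => (star u ⬝ᵥ (H t).mulVec u).re := funext hray
    rw [← this]
    exact hop
  exact (coareaWegner_rayleigh_matrix_hasDerivAt H H' t₀ hderiv u).unique hop'

end Summit.QuantumFields.QCD.Cruxes.WegnerEstimate.ResolventCell

end
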